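import Summits.BirchSwinnertonDyer.BirchSwinnertonDyer.Theorems.KolyvaginRankRigidityAtTwoStartFrameOfParity
import Summits.BirchSwinnertonDyer.BirchSwinnertonDyer.Theorems.KolyvaginRankRigidityAtTwoWalkNearCore
import HarnessLib

/-!
# Crux U1 `KolyvaginBoundedDefectAtTwo` (stmt-BirchSwinnertonDyer-28083), LINE 17 `regular_core_rigidity`,
# stub S1b `stub_nearCoreExistenceAtTwo` — S1b VERBATIM, MODULO 2-PARITY OVER `K` (print)

Width seat `bsd-line-krr2-p2` g16 (ONE READER on S1b); `--supports stmt-BirchSwinnertonDyer-28083` (helper).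
THEOREMS ONLY; CONDITIONAL on the tree's named fact `Monsky1996_lemma14b_twoSelmerRank_parity` (Monsky 1996 Lemma 1.4(b) =
Kramer 1981 Thm. 1; print, unproved in the tree — the input reader g14 showed to be NECESSARY for the walk's odd frame);
nothing here proves S1b outright, U1, V1′∞, a rung or BSD. BSD is NOT proved. TRANSPLANT label (critic #171):
MR04 Cor. 2.7.3 / Howard04 Selmer-rank lowering → `p = 2` via REGULAR Kolyvagin primes.

`nearCoreExistenceAtTwo_of_twoSelmerParity h14`: the conclusion is BYTE-FOR-BYTE the body of the registered stub S1b
`NearCoreExistenceAtTwo` of LINE 17 v3 (`HOME/line17/regular_core_rigidity.lean`, skeleton sha b4a2711060ce), so inside the skeleton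
`theorem stub_nearCoreExistenceAtTwo (h14 : …) : NearCoreExistenceAtTwo := nearCoreExistenceAtTwo_of_twoSelmerParity h14` closes S1b
modulo print. It is the composition of the two tree theorems
* `startFrameAtTwo_of_twoSelmerParity` (`…StartFrameOfParity`, this seat): 2-parity over `K` ⟹ the START FRAME of `Sel_{2^k}(E/K)`
  (odd eigenframe of the divisible part of `Sel_{2^∞}(E/K)`, level-free signs, `J = k₀ + 1`, `d = 2`), and
* `nearCoreExistenceAtTwo_of_startFrame` (`…WalkNearCore`, g15 p700395): START FRAME ⟹ S1b by the regular-prime walk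
  (MR04 Cor. 2.7.3 induction at `p = 2` with (H.2) := regularity; supply `exists_regular_kolyvaginPrime_of_heegner` imported, not
  re-proved).
Honest residual of LINE 17 after this file: S0 (seed, `KolyvaginNonvanishingAtTwoFrame`), S2 (core rigidity), and the print `h14`.
[cite: MazurRubin2004, Cor. 2.7.3, §4.1 Prop. 4.1.5] [cite: Howard2004, Thm. 1.6.1] [cite: Jetchev2008, Prop. 5.3]
[cite: GrossLMS1991, §9 Prop. 9.1] [cite: Monsky1996, Lemma 1.4(b)] [cite: Kramer1981, Thm. 1] [cite: Greenberg1999, §1–2]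
Design: no definitions; `K : Type`; axioms `propext`, `Classical.choice`, `Quot.sound`.
-/

set_option autoImplicit false
-- the Theorems namespace of this sub repeats the summit name by design (D-0017 nested layout)
set_option linter.dupNamespace false

noncomputable section

open scoped Classical
open Function NumberField IsDedekindDomain WeierstrassCurve Field Finset
open Literature.NumberTheory.EllipticCurves Literature.NumberTheory.EllipticCurves.Jetchev2008
open Literature.NumberTheory.EllipticCurves.KolyvaginPairing
open Literature.NumberTheory.GaloisRepresentations Literature.NumberTheory.GaloisCohomology
open Literature.NumberTheory.GaloisRepresentations.DiscreteGaloisModule (transverseSubgroup SelmerStructure)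
open Literature.NumberTheory.Automorphic Literature.NumberTheory
open Summit.BirchSwinnertonDyer.Rank1Residual
open Summit.BirchSwinnertonDyer.Rank1Residual.JET.SelmerVocabulary

namespace Summit.BirchSwinnertonDyer.BirchSwinnertonDyer.Theorems.KolyvaginAtTwo.RegularWalk

/-- **S1b `NearCoreExistenceAtTwo` (LINE 17 v3, VERBATIM) MODULO 2-PARITY OVER `K`.** On U1's habitat there are a depth `r` and an
error `κ` such that at every level `M ≥ 1` and beyond every bound `b` some square-free conductor `n` with exactly `r` prime factors —
all Zhang–Kolyvagin primes at `2`, `> b`, of Kolyvagin index `≥ M` and REGULAR at level `2^M` — carries a near-core vertex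
`H_{𝓕(n)}` with a class `x` of exact order `2^M` and `2^κ · H_{𝓕(n)} ⊆ ℤ x`. Conditional on `h14` (print) only:
start frame (`startFrameAtTwo_of_twoSelmerParity`) + regular-prime walk (`nearCoreExistenceAtTwo_of_startFrame`).
[cite: MazurRubin2004, Cor. 2.7.3, §4.1 Prop. 4.1.5] [cite: Jetchev2008, Prop. 5.3] [cite: GrossLMS1991, §9 Prop. 9.1]
[cite: Monsky1996, Lemma 1.4(b)] [cite: Kramer1981, Thm. 1] -/
theorem nearCoreExistenceAtTwo_of_twoSelmerParity (h14 : Monsky1996_lemma14b_twoSelmerRank_parity) :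
    ∀ (W : WeierstrassCurve ℚ) [W.IsElliptic] [W.IsGloballyMinimal], ¬ W.HasCM → (Literature.NumberTheory.EllipticCurves.Rank1Residual.GoodOrd W 2 ∨ Literature.NumberTheory.EllipticCurves.Rank1Residual.Mult W 2) → (∀ m : ℕ, W.HasSurjectiveModNGaloisRep (2 ^ m : ℕ)) → ∀ (K : Type) [Field K] [NumberField K], Literature.NumberTheory.EllipticCurves.IsImaginaryQuadratic K → ∀ [NeZero (W.conductorNorm ℤ)], Literature.NumberTheory.EllipticCurves.SatisfiesHeegnerHypothesis (W.conductorNorm ℤ) K → Odd (NumberField.discr K) → NumberField.discr K ≠ -3 → AddSubgroup.torsionBy (W.baseChange K).toAffine.Point (2 : ℤ) = ⊥ → Literature.NumberTheory.EllipticCurves.SatisfiesHeegnerHypothesis 2 K → ∀ (Dt : Literature.NumberTheory.EllipticCurves.ModularForms.ModularParametrizationData W (W.conductorNorm ℤ)) (β : ℤ) (ι : K →+* ℂ) [∀ k : ℕ, NumberField (ringClassField K ι k)], (4 * (W.conductorNorm ℤ : ℤ)) ∣ β ^ 2 - NumberField.discr K →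
    ∃ r κ : ℕ, ∀ (M b : ℕ), 1 ≤ M →
      ∃ n : ℕ, Squarefree n ∧ n.primeFactors.card = r ∧
        (∀ ℓ ∈ n.primeFactors, Literature.NumberTheory.EllipticCurves.Zhang2014.IsKolyvaginPrime (W.conductorNorm ℤ) W K 2 ℓ ∧ b < ℓ ∧
          M ≤ Literature.NumberTheory.EllipticCurves.Zhang2014.kolyvaginIndex W 2 ℓ ∧ (∃ (v : HeightOneSpectrum (𝓞 ℚ)) (𝔓 : Ideal (absIntegers (𝓞 ℚ) ℚ)) (h : absoluteGaloisGroup ℚ), (ℓ : 𝓞 ℚ) ∈ v.asIdeal ∧ 𝔓 ∈ v.primesAbove ∧ IsArithFrobAt (𝓞 ℚ) h 𝔓 ∧ (∀ X : geomTorsion W ((2 ^ M : ℕ) : ℤ), h • h • X = X) ∧ ∃ P : geomTorsion W ((2 ^ M : ℕ) : ℤ), (2 : ℤ) ^ (M - 1) • (P + h • P) ≠ 0)) ∧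
        (∃ x ∈ Jetchev2008.modifiedSelmerGroup W K ι ((2 ^ M : ℕ) : ℤ) n, addOrderOf x = 2 ^ M ∧ ∀ y ∈ Jetchev2008.modifiedSelmerGroup W K ι ((2 ^ M : ℕ) : ℤ) n, ∃ t : ℤ, (2 ^ κ : ℤ) • y = t • x) :=
  nearCoreExistenceAtTwo_of_startFrame (startFrameAtTwo_of_twoSelmerParity h14)

end Summit.BirchSwinnertonDyer.BirchSwinnertonDyer.Theorems.KolyvaginAtTwo.RegularWalk

end
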